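import Summits.Ventures.QEC.Census.CSSNormalFormSAT.EncodeSoundCore
import HarnessLib

/-!
# Soundness of the explicit-index encoding, part 1: the valuation of a Boolean matrix and the `(Z)`/`(X)` families (KERNEL-PLAN item 2)

For `c : NFEnc.Cfg` and a Boolean matrix `P : ℕ → ℕ → Bool` (row `i < b`, column `j < m`) we define the Boolean assignment `assign c P`
of ALL DIMACS variables of `NFEnc.cnf c` by decoding the explicit index layout of `Encode.lean` (`pv / zv / xv / ev`), prove the decoding
lemmas, and show that the `(Z)` family `zClauses c` and the `(X)` family `xClauses c` are satisfied by `valOf (assign c P)` under the Boolean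
normal-form hypotheses `ZCond` / `XCond` (the counting form of `(Z)`/`(X)`: for every listed row set `V`, `d ≤ |V| + #{j < m : s_j ⊕ ⊕_{i∈V} P i j}`,
and dually). The lex family and the final assembly are part 2. [folklore]
-/

set_option autoImplicit false

namespace Summit.Ventures.QEC.Census.CSSNormalFormSAT

open NFEnc

/-- Parity of `l ++ [a]`. [folklore] -/
theorem parity_append_singleton (l : List Bool) (a : Bool) : parity (l ++ [a]) = xor (parity l) a := by
  induction l with
  | nil => simp [parity]
  | cons x xs ih => simp [parity, ih]

/-- The `j`-th column bit of the XOR of the rows `V`, plus `s_j` (`s = 1^w 0^{m−w}`). (definition) -/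
def zvalOf (c : Cfg) (P : ℕ → ℕ → Bool) (V : List ℕ) (j : ℕ) : Bool :=
  xor (decide (j < c.w)) (parity (V.map fun i => P i j))

/-- The `i`-th row bit of the XOR of the columns `U`. (definition) -/
def xvalOf (P : ℕ → ℕ → Bool) (U : List ℕ) (i : ℕ) : Bool := parity (U.map fun j => P i j)

/-- The value of the matrix variable with DIMACS index `x` (`x = 1 + i·m + j`). (definition) -/
def pbit (c : Cfg) (P : ℕ → ℕ → Bool) (x : ℕ) : Bool := P ((x - 1) / c.m) ((x - 1) % c.m)

/-- The Boolean assignment of all variables of `NFEnc.cnf c` determined by `P` (and, for the lex auxiliaries, by a function `ev` supplied by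
part 2; here an arbitrary `evalAux`). (definition) -/
def assign (c : Cfg) (P : ℕ → ℕ → Bool) (evalAux : ℕ → ℕ → Bool) (x : ℕ) : Bool :=
  if x ≤ c.b * c.m then pbit c P x
  else if x ≤ c.b * c.m + c.NZ * c.m then
    let y := x - c.b * c.m - 1
    zvalOf c P ((rowSets c.d c.b).getD (y / c.m) []) (y % c.m)
  else if x ≤ c.b * c.m + c.NZ * c.m + c.NX * c.b then
    let y := x - (c.b * c.m + c.NZ * c.m) - 1
    xvalOf P ((colSets c.d c.m c.w).getD (y / c.b) []) (y % c.b)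
  else
    let y := x - (c.b * c.m + c.NZ * c.m + c.NX * c.b) - 1
    evalAux (y / c.L) (y % c.L)

section Decoding

variable (c : Cfg) (P : ℕ → ℕ → Bool) (ea : ℕ → ℕ → Bool)

/-- Decoding of a matrix variable: `assign (pv i j) = P i j`. [folklore] -/
theorem assign_pv {i j : ℕ} (hi : i < c.b) (hj : j < c.m) :
    assign c P ea (c.pv i j).toNat = P i j := by
  have hm : 0 < c.m := by omega
  have h1 : (c.pv i j).toNat = 1 + i * c.m + j := rfl
  have hle : 1 + i * c.m + j ≤ c.b * c.m := by
    have : i * c.m + c.m ≤ c.b * c.m := by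
      have := Nat.mul_le_mul_right c.m hi; simpa [Nat.succ_mul] using this
    omega
  rw [h1, assign, if_pos hle, pbit]
  have hq : (1 + i * c.m + j - 1) = j + c.m * i := by rw [Nat.mul_comm]; omega
  rw [hq, Nat.add_mul_div_left _ _ hm, Nat.add_mul_mod_self_left, Nat.div_eq_of_lt hj, Nat.mod_eq_of_lt hj]
  simp

/-- Decoding of a `(Z)` auxiliary: `assign (zv t j) = zvalOf (V_t) j`. [folklore] -/
theorem assign_zv {t j : ℕ} (ht : t < c.NZ) (hj : j < c.m) :
    assign c P ea (c.zv t j).toNat = zvalOf c P ((rowSets c.d c.b).getD t []) j := by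
  have hm : 0 < c.m := by omega
  have h1 : (c.zv t j).toNat = 1 + c.b * c.m + t * c.m + j := rfl
  have hgt : ¬ 1 + c.b * c.m + t * c.m + j ≤ c.b * c.m := by omega
  have hle : 1 + c.b * c.m + t * c.m + j ≤ c.b * c.m + c.NZ * c.m := by
    have : t * c.m + c.m ≤ c.NZ * c.m := by
      have := Nat.mul_le_mul_right c.m ht; simpa [Nat.succ_mul] using this
    omega
  rw [h1, assign, if_neg hgt, if_pos hle]
  have hq : 1 + c.b * c.m + t * c.m + j - c.b * c.m - 1 = j + c.m * t := by rw [Nat.mul_comm t]; omega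
  simp only [hq, Nat.add_mul_div_left _ _ hm, Nat.add_mul_mod_self_left, Nat.div_eq_of_lt hj, Nat.mod_eq_of_lt hj, zero_add]

/-- Decoding of an `(X)` auxiliary: `assign (xv t i) = xvalOf (U_t) i`. [folklore] -/
theorem assign_xv {t i : ℕ} (ht : t < c.NX) (hi : i < c.b) :
    assign c P ea (c.xv t i).toNat = xvalOf P ((colSets c.d c.m c.w).getD t []) i := by
  have hb : 0 < c.b := by omega
  have h1 : (c.xv t i).toNat = 1 + c.b * c.m + c.NZ * c.m + t * c.b + i := rfl
  have hgt1 : ¬ 1 + c.b * c.m + c.NZ * c.m + t * c.b + i ≤ c.b * c.m := by omega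
  have hgt2 : ¬ 1 + c.b * c.m + c.NZ * c.m + t * c.b + i ≤ c.b * c.m + c.NZ * c.m := by omega
  have hle : 1 + c.b * c.m + c.NZ * c.m + t * c.b + i ≤ c.b * c.m + c.NZ * c.m + c.NX * c.b := by
    have : t * c.b + c.b ≤ c.NX * c.b := by
      have := Nat.mul_le_mul_right c.b ht; simpa [Nat.succ_mul] using this
    omega
  rw [h1, assign, if_neg hgt1, if_neg hgt2, if_pos hle]
  have hq : 1 + c.b * c.m + c.NZ * c.m + t * c.b + i - (c.b * c.m + c.NZ * c.m) - 1 = i + c.b * t := by rw [Nat.mul_comm t]; omega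
  simp only [hq, Nat.add_mul_div_left _ _ hb, Nat.add_mul_mod_self_left, Nat.div_eq_of_lt hi, Nat.mod_eq_of_lt hi, zero_add]

end Decoding

section Families

variable (c : Cfg) (P : ℕ → ℕ → Bool) (ea : ℕ → ℕ → Bool)

/-- Entries of a row set are `< b`. [folklore] -/
theorem lt_of_mem_rowSets {V : List ℕ} (hV : V ∈ rowSets c.d c.b) : ∀ i ∈ V, i < c.b := by
  simp only [rowSets, List.mem_flatMap, List.mem_range] at hV
  obtain ⟨t, -, ht⟩ := hV
  exact (combos_spec _ _ V ht).2.2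

/-- Entries of a column set are `< m`. [folklore] -/
theorem lt_of_mem_colSets {U : List ℕ} (hU : U ∈ colSets c.d c.m c.w) : ∀ j ∈ U, j < c.m := by
  simp only [colSets, List.mem_flatMap, List.mem_range, List.mem_filter] at hU
  obtain ⟨t, -, ht, -⟩ := hU
  exact (combos_spec _ _ U ht).2.2

/-- `((range n).map f).getD j 0 = f j` for `j < n`. [folklore] -/
theorem getD_map_range {α : Type*} [Inhabited α] (f : ℕ → α) (d : α) {n j : ℕ} (hj : j < n) :
    ((List.range n).map f).getD j d = f j := by
  rw [List.getD_eq_getElem?_getD, List.getElem?_map, List.getElem?_range hj]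
  rfl

/-- The counting form of condition `(Z)`: for every listed row set `V`, `d ≤ |V| + #{j < m : s_j ⊕ ⊕_{i∈V} P i j = 1}`. (definition) -/
def ZCond : Prop :=
  ∀ V ∈ rowSets c.d c.b, c.d ≤ V.length + ((Finset.range c.m).filter fun j => zvalOf c P V j = true).card

/-- The counting form of condition `(X)`: for every listed column set `U` (odd on `S`), `d ≤ |U| + #{i < b : ⊕_{j∈U} P i j = 1}`. (definition) -/
def XCond : Prop :=
  ∀ U ∈ colSets c.d c.m c.w, c.d ≤ U.length + ((Finset.range c.b).filter fun i => xvalOf P U i = true).card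

/-- **The `(Z)` family is satisfied** by the assignment of `P` when `ZCond` holds. [folklore] -/
theorem satisfies_zClauses (hZ : ZCond c P) :
    ∀ cl ∈ zClauses c, (valOf (assign c P ea)).satisfies (cl.map Sat.Literal.ofInt) := by
  intro cl hcl
  simp only [zClauses, List.mem_flatMap] at hcl
  obtain ⟨⟨v, t⟩, hvt, hcl⟩ := hcl
  have hget : (rowSets c.d c.b)[t]? = some v := List.mem_zipIdx_iff_getElem?.1 hvt
  have ht : t < c.NZ := by
    have := List.getElem?_eq_some_iff.1 hget; exact this.1
  have hv : (rowSets c.d c.b).getD t [] = v := by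
    rw [List.getD_eq_getElem?_getD, hget]; rfl
  have hvmem : v ∈ rowSets c.d c.b := List.mem_of_getElem? hget
  have hvlt := lt_of_mem_rowSets c hvmem
  rcases List.mem_append.1 hcl with hdef | hatl
  · -- XOR definitions of the z_{t,j}
    simp only [List.mem_flatMap, List.mem_range] at hdef
    obtain ⟨j, hj, hmem⟩ := hdef
    refine satisfies_xorClauses (assign c P ea) _ _ _ ?_ ?_ ?_ cl hmem
    · intro v' hv'
      obtain ⟨i, -, rfl⟩ := List.mem_map.1 hv'
      show (1 : ℤ) ≤ ((1 + i * c.m + j : ℕ) : ℤ); omega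
    · show (1 : ℤ) ≤ ((1 + c.b * c.m + t * c.m + j : ℕ) : ℤ); omega
    · rw [List.map_append, List.map_singleton, parity_append_singleton, assign_zv c P ea ht hj, hv, List.map_map]
      have hmapeq : v.map ((fun v : ℤ => assign c P ea v.toNat) ∘ fun i => c.pv i j) = v.map fun i => P i j := by
        apply List.map_congr_left
        intro i hi
        exact assign_pv c P ea (hvlt i hi) hj
      rw [hmapeq, zvalOf]
      cases decide (j < c.w) <;> cases parity (v.map fun i => P i j) <;> rfl
  · -- at least d − |v| of the z_{t,j} are true
    refine satisfies_atLeast (assign c P ea) _ _ ?_ ?_ cl hatl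
    · intro z hz
      obtain ⟨j, -, rfl⟩ := List.mem_map.1 hz
      show (1 : ℤ) ≤ ((1 + c.b * c.m + t * c.m + j : ℕ) : ℤ); omega
    · have hlen : ((List.range c.m).map fun j => c.zv t j).length = c.m := by simp
      rw [hlen]
      have hset : ((Finset.range c.m).filter fun j =>
            assign c P ea (((List.range c.m).map fun j => c.zv t j).getD j 0).toNat = true) =
          ((Finset.range c.m).filter fun j => zvalOf c P v j = true) := by
        apply Finset.filter_congr
        intro j hj
        rw [Finset.mem_range] at hj
        rw [getD_map_range _ _ hj, assign_zv c P ea ht hj, hv]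
      rw [hset]
      have := hZ v hvmem
      change c.d - v.length ≤ _
      omega

/-- **The `(X)` family is satisfied** by the assignment of `P` when `XCond` holds. [folklore] -/
theorem satisfies_xClauses (hX : XCond c P) :
    ∀ cl ∈ xClauses c, (valOf (assign c P ea)).satisfies (cl.map Sat.Literal.ofInt) := by
  intro cl hcl
  simp only [xClauses, List.mem_flatMap] at hcl
  obtain ⟨⟨u, t⟩, hut, hcl⟩ := hcl
  have hget : (colSets c.d c.m c.w)[t]? = some u := List.mem_zipIdx_iff_getElem?.1 hut
  have ht : t < c.NX := by
    have := List.getElem?_eq_some_iff.1 hget; exact this.1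
  have hu : (colSets c.d c.m c.w).getD t [] = u := by
    rw [List.getD_eq_getElem?_getD, hget]; rfl
  have humem : u ∈ colSets c.d c.m c.w := List.mem_of_getElem? hget
  have hult := lt_of_mem_colSets c humem
  rcases List.mem_append.1 hcl with hdef | hatl
  · simp only [List.mem_flatMap, List.mem_range] at hdef
    obtain ⟨i, hi, hmem⟩ := hdef
    refine satisfies_xorClauses (assign c P ea) _ _ _ ?_ ?_ ?_ cl hmem
    · intro v' hv'
      obtain ⟨j, -, rfl⟩ := List.mem_map.1 hv'
      show (1 : ℤ) ≤ ((1 + i * c.m + j : ℕ) : ℤ); omega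
    · show (1 : ℤ) ≤ ((1 + c.b * c.m + c.NZ * c.m + t * c.b + i : ℕ) : ℤ); omega
    · rw [List.map_append, List.map_singleton, parity_append_singleton, assign_xv c P ea ht hi, hu, List.map_map]
      have hmapeq : u.map ((fun v : ℤ => assign c P ea v.toNat) ∘ fun j => c.pv i j) = u.map fun j => P i j := by
        apply List.map_congr_left
        intro j hj
        exact assign_pv c P ea hi (hult j hj)
      rw [hmapeq, xvalOf]
      cases parity (u.map fun j => P i j) <;> rfl
  · refine satisfies_atLeast (assign c P ea) _ _ ?_ ?_ cl hatl
    · intro z hz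
      obtain ⟨i, -, rfl⟩ := List.mem_map.1 hz
      show (1 : ℤ) ≤ ((1 + c.b * c.m + c.NZ * c.m + t * c.b + i : ℕ) : ℤ); omega
    · have hlen : ((List.range c.b).map fun i => c.xv t i).length = c.b := by simp
      rw [hlen]
      have hset : ((Finset.range c.b).filter fun i =>
            assign c P ea (((List.range c.b).map fun i => c.xv t i).getD i 0).toNat = true) =
          ((Finset.range c.b).filter fun i => xvalOf P u i = true) := by
        apply Finset.filter_congr
        intro i hi
        rw [Finset.mem_range] at hi
        rw [getD_map_range _ _ hi, assign_xv c P ea ht hi, hu]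
      rw [hset]
      have := hX u humem
      change c.d - u.length ≤ _
      omega

end Families

end Summit.Ventures.QEC.Census.CSSNormalFormSAT
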